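import Literature.Computability.AlgebraicComplexity.UABPToolkit
import Mathlib.RingTheory.Localization.Integer
import Mathlib.RingTheory.Localization.FractionRing
import Mathlib.Algebra.MvPolynomial.Funext
import Mathlib.FieldTheory.RatFunc.AsPolynomial
import HarnessLib

/-!
# Descent of ABPs with univariate labels from `F(y)` (and `F(ε)`) to the base field `F` (proved)

Typed literature (cell `val-lit`, cross-ladder typing row X2-DDS21, brick E4.3 "UABP descent" of
the `(A′)` architecture for DDS Thm. 3.2; desk lead-np). Source: P. Dutta, P. Dwivedi, N. Saxena,
*Demystifying the border of depth-3 algebraic circuits*, FOCS 2021 / full version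
[DuttaDwivediSaxena2022] (held text `paper:galaxy-pdf-7641649743695546420`).

In the proof of DDS Thm. 3.2 (§3, "DiDIL") the input is first shifted by a RANDOM point
`α ∈ Fⁿ` (the map `Φ : x_i ↦ z·x_i + α_i`, "`α_i` are random elements in `F`", p0028
L751–754) so that finitely many polynomial non-vanishing conditions hold at `α`; at the end
`Φ⁻¹` is applied and the resulting ABP is over `F` (p0036 L958–962). In the tree's rendering of
that proof (architecture note `(A′)` of the `val-lit` cell) the random point is replaced by the
tuple of INDETERMINATES `y`: the whole induction is run over the rational function field
`F′ = F(y) = Frac F[y]`, where every "`P(α) ≠ 0` for random `α`" is the identity `P ≠ 0`, and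
ONE descent step at the very end replaces an ABP over `F(y)` computing `f ∈ F[x] ⊂ F(y)[x]` by
an ABP over `F` of the SAME size computing `f`. This file PROVES that descent step for the
tree's predicates `DDS2021.UABPComputes S f` / `DDS2021.UABPComputesLen S L f` (DDS Def. 2.5,
`DDS21BorderDepthThree.lean` / `UABPToolkit.lean`):

* `UABPComputesLen.descend` / `UABPComputes.descend` — GENERIC form: `F` a field, `R` an
  `F`-algebra and a domain with fraction field `K`, and `R` has "enough `F`-points"
  (`∀ b ≠ 0, ∃ ψ : R →ₐ[F] F, ψ b ≠ 0`); then a program over `K` for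
  `map (algebraMap F K) f` yields a program over `F` for `f` with the same vertex set,
  layering, length and budget. Proof: a common denominator `b ∈ R ∖ {0}` of the finitely many
  label coefficients (`IsLocalization.exist_integer_multiples_of_finset`), an integral label
  matrix `P` over `R` with `map P = C b • N`, the polynomial identity
  `(P ^ L) s t = C (b ^ L) · f` over `R` (injectivity of `R → K`), pushed along an `F`-point
  `ψ` with `ψ b ≠ 0` and rescaled by `C (ψ b)⁻¹` on every label; supports of the new labels
  are contained in those of the old ones, so "univariate of degree `≤ S`" and the layering
  are kept. Also `UABPComputes.map_iff_of_points`.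
* `uabpComputesLen_descend_fractionRing` / ★ `uabpComputes_descend_fractionRing` — the
  instance `R = MvPolynomial τ F`, `K = FractionRing (MvPolynomial τ F)` for an INFINITE field
  `F` (`F`-points from `MvPolynomial.funext`: `exists_algHom_mvPolynomial_ne_zero`), in the
  signature requested by the architecture note; `uabpComputes_map_fractionRing_iff`.
* `uabpComputesLen_descend_ratFunc` / `uabpComputes_descend_ratFunc` /
  `uabpComputes_map_ratFunc_iff` — the instance `R = F[X]`, `K = RatFunc F = F(ε)`: an EXACT
  computation over `F(ε)` of a polynomial with coefficients in `F` descends to `F` (this is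
  NOT de-bordering: the hypothesis is exact computation over `F(ε)`, not approximation).

Typed vs printed: the printed proof fixes a random `α ∈ Fⁿ` (the paper's standing assumption,
§2 "Field", p0015: characteristic `0`, "all our results hold for other fields … of large
characteristic"; in particular `F` is infinite, which is the hypothesis used here); the descent
lemma is the field-theoretic content of that choice, isolated as generic ABP infrastructure.
0 named facts, 0 definitions; every declaration is proved. Honest framing: plumbing for the
tree's DDS21 programme; the named fact `DDS2021_thm_3_2` is untouched by this file; VP ≠ VNP is
not addressed.
-/

namespace Literature.Computability.AlgebraicComplexity

namespace DDS2021

open MvPolynomial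

/-! ## Support bookkeeping -/

section Support

variable {A B : Type*} [CommSemiring A] [CommSemiring B] {σ : Type*}

/-- If the support of `p` is contained in the support of `q` (possibly over another coefficient
ring) then every variable occurring in `p` occurs in `q`. [folklore] -/
private theorem vars_subset_of_support_subset {p : MvPolynomial σ A} {q : MvPolynomial σ B}
    (h : p.support ⊆ q.support) : p.vars ⊆ q.vars := by
  intro i hi
  rw [mem_vars_iff_mem_support] at hi ⊢
  obtain ⟨d, hd, hid⟩ := hi
  exact ⟨d, h hd, hid⟩

/-- If the support of `p` is contained in the support of `q` then
`totalDegree p ≤ totalDegree q`. [folklore] -/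
private theorem totalDegree_le_of_support_subset {p : MvPolynomial σ A} {q : MvPolynomial σ B}
    (h : p.support ⊆ q.support) : p.totalDegree ≤ q.totalDegree :=
  Finset.sup_mono h

/-- `support (C a * p) ⊆ support p`. [folklore] -/
private theorem support_C_mul_subset (a : A) (p : MvPolynomial σ A) :
    (C a * p).support ⊆ p.support := by
  intro m hm
  rw [mem_support_iff] at hm ⊢
  rw [coeff_C_mul] at hm
  intro h0
  exact hm (by rw [h0, mul_zero])

/-- Over a field, multiplication by a nonzero constant does not change the support. [folklore] -/
private theorem support_C_mul_of_ne_zero {K : Type*} [Field K] {a : K} (ha : a ≠ 0)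
    (p : MvPolynomial σ K) : (C a * p).support = p.support := by
  ext m
  rw [mem_support_iff, mem_support_iff, coeff_C_mul, mul_ne_zero_iff]
  exact ⟨fun h => h.2, fun h => ⟨ha, h⟩⟩

end Support

/-! ## Common denominators for finitely many polynomials over a fraction field -/

section Denominators

variable {R : Type*} [CommRing R] {K : Type*} [CommRing K] [Algebra R K] [IsFractionRing R K]
  {σ : Type*}

/-- **Common denominator.** Finitely many polynomials `N i` over the fraction field `K` of `R`
become polynomials over `R` after multiplication by ONE non-zero-divisor `b ∈ R`:
`map (algebraMap R K) (P i) = C b · N i`. (The finitely many label coefficients of an ABP over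
`F(y)` have a common denominator `D(y)`.)
[cite: DuttaDwivediSaxena2022, §3 proof of Thm. 3.2, "Size blowup … Apply the map `Φ⁻¹`" (full version p0036 L958–962)] -/
theorem exists_common_denominator {ι : Type*} [Fintype ι] (N : ι → MvPolynomial σ K) :
    ∃ b : R, b ∈ nonZeroDivisors R ∧ ∃ P : ι → MvPolynomial σ R,
      ∀ i, map (algebraMap R K) (P i) = C (algebraMap R K b) * N i := by
  classical
  let s : Finset K := Finset.univ.biUnion fun i => (N i).support.image fun m => coeff m (N i)
  obtain ⟨b, hb⟩ := IsLocalization.exist_integer_multiples_of_finset (nonZeroDivisors R) s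
  have key : ∀ i m, ∃ y : R, algebraMap R K y = algebraMap R K b * coeff m (N i) := by
    intro i m
    by_cases hm : m ∈ (N i).support
    · have hmem : coeff m (N i) ∈ s :=
        Finset.mem_biUnion.mpr ⟨i, Finset.mem_univ _, Finset.mem_image.mpr ⟨m, hm, rfl⟩⟩
      obtain ⟨y, hy⟩ := RingHom.mem_rangeS.mp (hb _ hmem)
      exact ⟨y, by rw [hy, Algebra.smul_def]⟩
    · rw [notMem_support_iff] at hm
      exact ⟨0, by rw [hm, mul_zero, map_zero]⟩
  choose g hg using key
  refine ⟨b, b.2, fun i => ∑ m ∈ (N i).support, monomial m (g i m), fun i => ?_⟩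
  rw [map_sum]
  simp only [map_monomial, hg]
  conv_rhs => rw [(N i).as_sum, Finset.mul_sum]
  refine Finset.sum_congr rfl fun m _ => ?_
  rw [C_mul_monomial]

end Denominators

/-! ## The generic descent theorem -/

section Descent

variable {F : Type*} [Field F] {R : Type*} [CommRing R] [IsDomain R] [Algebra F R]
  {K : Type*} [Field K] [Algebra R K] [IsFractionRing R K] [Algebra F K] [IsScalarTower F R K]
  {n : ℕ}

/-- **Descent of ABPs along `F`-points (length-aware form).** Let `R` be an `F`-algebra and a
domain, `K = Frac R`, and assume every `b ≠ 0` in `R` survives some `F`-point `ψ : R →ₐ[F] F`.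
If `f ∈ F[x]`, viewed in `K[x]`, has a layered program with univariate labels on `≤ S` vertices,
label degrees `≤ S`, length `L`, then `f` has such a program over `F` with the same `S, L`
(indeed the same graph): clear the common denominator `b` of the labels, specialise along `ψ`
with `ψ b ≠ 0`, rescale every label by `(ψ b)⁻¹`. This is the field-theoretic content of
"choose a random `α ∈ Fⁿ` … apply `Φ⁻¹`" in the proof of Thm. 3.2.
[cite: DuttaDwivediSaxena2022, §3 proof of Thm. 3.2 (full version p0028 L751–754; p0036 L958–962)] -/
theorem UABPComputesLen.descend (hpt : ∀ b : R, b ≠ 0 → ∃ ψ : R →ₐ[F] F, ψ b ≠ 0)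
    {S L : ℕ} {f : MvPolynomial (Fin n) F}
    (hf : UABPComputesLen S L (MvPolynomial.map (algebraMap F K) f)) : UABPComputesLen S L f := by
  classical
  obtain ⟨V, hV, layer, s, t, N, hlay, hlab, hst, hNf⟩ := hf
  -- (1) common denominator of all labels, integral label matrix `Pm` over `R`
  obtain ⟨b, hb, P, hP⟩ :=
    exists_common_denominator (R := R) (fun uv : Fin V × Fin V => N uv.1 uv.2)
  have hb0 : b ≠ 0 := nonZeroDivisors.ne_zero hb
  have hinj : Function.Injective (algebraMap R K) := IsFractionRing.injective R K
  have hKb : algebraMap R K b ≠ 0 := fun h => hb0 (hinj (by rw [h, map_zero]))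
  obtain ⟨Pm, hPmuv⟩ : ∃ Pm : Matrix (Fin V) (Fin V) (MvPolynomial (Fin n) R),
      ∀ u v, Pm u v = P (u, v) := ⟨Matrix.of fun u v => P (u, v), fun _ _ => rfl⟩
  have hPm : Pm.map (MvPolynomial.map (algebraMap R K)) =
      (C (algebraMap R K b) : MvPolynomial (Fin n) K) • N :=
    Matrix.ext fun u v => by
      rw [Matrix.map_apply, Matrix.smul_apply, smul_eq_mul, hPmuv, hP]
  -- (2) the polynomial identity `(Pm ^ L) s t = C (b ^ L) * f` over `R`
  have hPmL : MvPolynomial.map (algebraMap R K) ((Pm ^ L) s t) =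
      C (algebraMap R K b) ^ L * MvPolynomial.map (algebraMap F K) f := by
    have h1 : (Pm ^ L).map (MvPolynomial.map (algebraMap R K)) =
        (C (algebraMap R K b) : MvPolynomial (Fin n) K) ^ L • N ^ L := by
      rw [Matrix.map_pow, hPm, smul_pow]
    have h2 := congr_fun (congr_fun h1 s) t
    rw [Matrix.map_apply, Matrix.smul_apply, smul_eq_mul, hNf] at h2
    exact h2
  have hident : (Pm ^ L) s t = C (b ^ L) * MvPolynomial.map (algebraMap F R) f := by
    apply map_injective (algebraMap R K) hinj
    rw [hPmL, map_mul, map_C, map_pow, map_map, ← IsScalarTower.algebraMap_eq, map_pow]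
  -- (3) specialise along an `F`-point `ψ` with `ψ b ≠ 0`, rescale by `(ψ b)⁻¹`
  obtain ⟨ψ, hψ⟩ := hpt b hb0
  let N' : Matrix (Fin V) (Fin V) (MvPolynomial (Fin n) F) :=
    (C (ψ b)⁻¹ : MvPolynomial (Fin n) F) • Pm.map (MvPolynomial.map (ψ : R →+* F))
  have hN'uv : ∀ u v, N' u v = C (ψ b)⁻¹ * MvPolynomial.map (ψ : R →+* F) (P (u, v)) :=
    fun u v => by
    show ((C (ψ b)⁻¹ : MvPolynomial (Fin n) F) •
      Pm.map (MvPolynomial.map (ψ : R →+* F))) u v = _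
    rw [Matrix.smul_apply, smul_eq_mul, Matrix.map_apply, hPmuv]
  have hsupp : ∀ u v, (N' u v).support ⊆ (N u v).support := fun u v =>
    calc (N' u v).support
          = (C (ψ b)⁻¹ * MvPolynomial.map (ψ : R →+* F) (P (u, v))).support := by rw [hN'uv]
      _ ⊆ (MvPolynomial.map (ψ : R →+* F) (P (u, v))).support := support_C_mul_subset _ _
      _ ⊆ (P (u, v)).support := support_map_subset _ _
      _ = (MvPolynomial.map (algebraMap R K) (P (u, v))).support :=
          (support_map_of_injective _ hinj).symm
      _ = (C (algebraMap R K b) * N u v).support := by rw [hP]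
      _ = (N u v).support := support_C_mul_of_ne_zero hKb _
  refine ⟨V, hV, layer, s, t, N', ?_, ?_, hst, ?_⟩
  · -- layering: a nonzero new label sits where a nonzero old label sat
    intro u v h
    apply hlay u v
    intro h0
    apply h
    have hs := hsupp u v
    rw [h0, support_zero, Finset.subset_empty, support_eq_empty] at hs
    exact hs
  · -- univariate labels of degree `≤ S`
    intro u v
    exact ⟨(Finset.card_le_card (vars_subset_of_support_subset (hsupp u v))).trans
        (hlab u v).1, (totalDegree_le_of_support_subset (hsupp u v)).trans (hlab u v).2⟩
  · -- the computed polynomial is `f`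
    show (((C (ψ b)⁻¹ : MvPolynomial (Fin n) F) •
      Pm.map (MvPolynomial.map (ψ : R →+* F))) ^ L) s t = f
    rw [smul_pow, Matrix.smul_apply, smul_eq_mul, ← Matrix.map_pow, Matrix.map_apply, hident,
      map_mul, map_C, map_pow, map_map, AlgHom.comp_algebraMap, Algebra.algebraMap_self, map_id,
      ← mul_assoc, ← C_pow, ← C_mul, ← mul_pow, AlgHom.coe_toRingHom, inv_mul_cancel₀ hψ,
      one_pow, C_1, one_mul]

/-- **Descent of ABPs along `F`-points** (DDS Def. 2.5 budget form): under the hypotheses of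
`UABPComputesLen.descend`,
`UABPComputes S (MvPolynomial.map (algebraMap F K) f) → UABPComputes S f`.
[cite: DuttaDwivediSaxena2022, §3 proof of Thm. 3.2 (full version p0028 L751–754; p0036 L958–962)] -/
theorem UABPComputes.descend (hpt : ∀ b : R, b ≠ 0 → ∃ ψ : R →ₐ[F] F, ψ b ≠ 0)
    {S : ℕ} {f : MvPolynomial (Fin n) F}
    (hf : UABPComputes S (MvPolynomial.map (algebraMap F K) f)) : UABPComputes S f := by
  obtain ⟨L, hL⟩ := hf.exists_len
  exact (hL.descend (F := F) (R := R) (K := K) hpt).uabpComputes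

/-- Base change and descent together: over `K = Frac R` with enough `F`-points, `f ∈ F[x]` has a
DDS ABP within budget `S` over `K` iff it has one over `F`.
[cite: DuttaDwivediSaxena2022, §3 proof of Thm. 3.2 (full version p0028 L751–754; p0036 L958–962)] -/
theorem UABPComputes.map_iff_of_points
    (hpt : ∀ b : R, b ≠ 0 → ∃ ψ : R →ₐ[F] F, ψ b ≠ 0) {S : ℕ}
    {f : MvPolynomial (Fin n) F} :
    UABPComputes S (MvPolynomial.map (algebraMap F K) f) ↔ UABPComputes S f :=
  ⟨fun h => h.descend (F := F) (R := R) (K := K) hpt, fun h => h.map _⟩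

end Descent

/-! ## `F`-points of polynomial rings over an infinite field -/

section Points

variable {F : Type*} [Field F] [Infinite F]

/-- Over an INFINITE field a nonzero polynomial in any set of variables has a non-vanishing
point: `b ≠ 0 ⇒ ∃ ψ = aeval x, ψ b ≠ 0` (`MvPolynomial.funext`). This is "`|F|` large enough
for a random point to avoid finitely many hypersurfaces" in the proof of Thm. 3.2.
[cite: DuttaDwivediSaxena2022, §3 proof of Thm. 3.2, "`α_i` are random elements in `F`" (full version p0028 L751–754)] -/
theorem exists_algHom_mvPolynomial_ne_zero {τ : Type*} {b : MvPolynomial τ F} (hb : b ≠ 0) :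
    ∃ ψ : MvPolynomial τ F →ₐ[F] F, ψ b ≠ 0 := by
  by_contra h
  push Not at h
  apply hb
  apply MvPolynomial.funext
  intro x
  rw [map_zero, ← coe_aeval_eq_eval]
  exact h (aeval x)

/-- Univariate version: over an infinite field a nonzero `b ∈ F[X]` has `b(x) ≠ 0` for some
`x ∈ F`, i.e. survives the `F`-point `aeval x`.
[cite: DuttaDwivediSaxena2022, §3 proof of Thm. 3.2, "`α_i` are random elements in `F`" (full version p0028 L751–754)] -/
theorem exists_algHom_polynomial_ne_zero {b : Polynomial F} (hb : b ≠ 0) :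
    ∃ ψ : Polynomial F →ₐ[F] F, ψ b ≠ 0 := by
  by_contra h
  push Not at h
  apply hb
  apply Polynomial.funext
  intro x
  rw [Polynomial.eval_zero, ← Polynomial.coe_aeval_eq_eval]
  exact h (Polynomial.aeval x)

end Points

/-! ## Descent from `F(y) = Frac F[y]` and from `F(ε) = RatFunc F` -/

section Instances

variable {F : Type*} [Field F] [Infinite F] {n : ℕ}

/-- **Descent from the rational function field `F(y)`** (length-aware form): for an infinite
field `F` and any set of indeterminates `τ`, a program over `Frac (F[y_τ])` for `f ∈ F[x]` gives
a program over `F` with the same budget and length.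
[cite: DuttaDwivediSaxena2022, §3 proof of Thm. 3.2 (full version p0028 L751–754; p0036 L958–962)] -/
theorem uabpComputesLen_descend_fractionRing {τ : Type*} {S L : ℕ} (f : MvPolynomial (Fin n) F)
    (hf : UABPComputesLen S L (map (algebraMap F (FractionRing (MvPolynomial τ F))) f)) :
    UABPComputesLen S L f :=
  hf.descend (F := F) (R := MvPolynomial τ F) (K := FractionRing (MvPolynomial τ F))
    fun _ hb => exists_algHom_mvPolynomial_ne_zero hb

/-- ★ **Descent from the rational function field `F(y)`**: for an infinite field `F` and any
set of indeterminates `τ`, `UABPComputes S (map (algebraMap F (Frac F[y_τ])) f) → UABPComputes S f`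
— the single descent step at the end of the `(A′)` rendering of the proof of Thm. 3.2 (run the
DiDIL induction over `F(y)` with `y` the generic point, then specialise).
[cite: DuttaDwivediSaxena2022, §3 proof of Thm. 3.2 (full version p0028 L751–754; p0036 L958–962)] -/
theorem uabpComputes_descend_fractionRing {τ : Type*} (f : MvPolynomial (Fin n) F) {S : ℕ}
    (hf : UABPComputes S (map (algebraMap F (FractionRing (MvPolynomial τ F))) f)) :
    UABPComputes S f :=
  hf.descend (F := F) (R := MvPolynomial τ F) (K := FractionRing (MvPolynomial τ F))
    fun _ hb => exists_algHom_mvPolynomial_ne_zero hb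

/-- Over an infinite field, `f ∈ F[x]` has a DDS ABP within budget `S` over `F(y)` iff over `F`.
[cite: DuttaDwivediSaxena2022, §3 proof of Thm. 3.2 (full version p0028 L751–754; p0036 L958–962)] -/
theorem uabpComputes_map_fractionRing_iff {τ : Type*} (f : MvPolynomial (Fin n) F) {S : ℕ} :
    UABPComputes S (map (algebraMap F (FractionRing (MvPolynomial τ F))) f) ↔
      UABPComputes S f :=
  ⟨uabpComputes_descend_fractionRing f, fun h => h.map _⟩

/-- **Descent from `F(ε) = RatFunc F`** (length-aware form): an EXACT program over `F(ε)` for a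
polynomial `f` with coefficients in the infinite field `F` gives one over `F` with the same budget
and length (clear denominators, specialise `ε` to a value where the common denominator does not
vanish). Not to be confused with de-bordering: the hypothesis is exact computation of `f` over
`F(ε)`, not approximation.
[cite: DuttaDwivediSaxena2022, §3 proof of Thm. 3.2 (full version p0028 L751–754; p0036 L958–962)] -/
theorem uabpComputesLen_descend_ratFunc {S L : ℕ} (f : MvPolynomial (Fin n) F)
    (hf : UABPComputesLen S L (map (algebraMap F (RatFunc F)) f)) : UABPComputesLen S L f :=
  hf.descend (F := F) (R := Polynomial F) (K := RatFunc F)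
    fun _ hb => exists_algHom_polynomial_ne_zero hb

/-- **Descent from `F(ε) = RatFunc F`**: `UABPComputes S (map (algebraMap F (RatFunc F)) f) →
UABPComputes S f` for an infinite field `F`.
[cite: DuttaDwivediSaxena2022, §3 proof of Thm. 3.2 (full version p0028 L751–754; p0036 L958–962)] -/
theorem uabpComputes_descend_ratFunc (f : MvPolynomial (Fin n) F) {S : ℕ}
    (hf : UABPComputes S (map (algebraMap F (RatFunc F)) f)) : UABPComputes S f :=
  hf.descend (F := F) (R := Polynomial F) (K := RatFunc F)
    fun _ hb => exists_algHom_polynomial_ne_zero hb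

/-- Over an infinite field, `f ∈ F[x]` has a DDS ABP within budget `S` over `F(ε)` iff over `F`.
[cite: DuttaDwivediSaxena2022, §3 proof of Thm. 3.2 (full version p0028 L751–754; p0036 L958–962)] -/
theorem uabpComputes_map_ratFunc_iff (f : MvPolynomial (Fin n) F) {S : ℕ} :
    UABPComputes S (map (algebraMap F (RatFunc F)) f) ↔ UABPComputes S f :=
  ⟨uabpComputes_descend_ratFunc f, fun h => h.map _⟩

end Instances

end DDS2021

end Literature.Computability.AlgebraicComplexity
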